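import Mathlib
import Literature.AlgebraicGeometry.Resolution.CobordantGame
import Summits.ResolutionOfSingularities.ResolutionOfSingularities.Theorems.WeightedInvariantLocalWeightedDropOffVertexConeWin
import Summits.ResolutionOfSingularities.ResolutionOfSingularities.Theorems.WeightedInvariantLocalWeightedDropTwistedTrivialWitnesses

/-!
# `WeightedInvariant.LocalWeightedDrop`: the UMBRELLA specimens of card A (§2 A0a/A0b) and HP Example 1 class B (§7 R3-HP1)

Route `ResolutionOfSingularities/WeightedInvariant`, crux `LocalWeightedDrop`
(stmt-ResolutionOfSingularities-8899).  [OURS · L1 W4.3] — three sorried calibration statements of ideator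
res-L1-w43-idea-1's `Sketch-L1-idea-1.lean` (v4) §2/§7, proved in the literal chart language of the crux
(`CobordantGame.cruxChart`, `CobordantGame.IsSingular`).  Nothing here is a statement of the manuscript under review on
ladder RESOLUTION; AI-produced, weaker than expert review.

* §2 A0b `umbrella_saturated_wins` — for `Z^q + x·y^{qm}` the SATURATED move (centre `V(Z, y) ⊇ x`-axis, weights
  `(m, 0, 1)`) has no singular successor: a corollary of the off-vertex one-move win
  `crux_move_wins_of_isWeightedHomogeneous_offVertex` (`…OffVertexConeWin`) — the germ is `(m,0,1)`-homogeneous of degree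
  `qm` and `P = ∂ₓP = 0` forces `c = 0` on the support `c₁ = 0`.  Every field, `q, m > 0`.
* §2 A0a `umbrella_reproduces` — REPRODUCTION IS TRANSLATION: `q = p^e`, the umbrella `Z^q + x y^q` under the pointwise lexmax
  move (weights `(q+1, q, q)`) has at the totally wild point `(0, γ^q, 0)` the singular successor
  `Z^q + (γ^q + x) y^q`, which is the cylinder over the umbrella after the twist `Z ↦ Z + γ y`.
* §7 R3-HP1 `hpB_reproduces` — HauserPerlega2019 Example 1, class `B` (char 2): `h = z⁸ + l⁴w⁸ + s·w⁶u¹⁰` under its ⊤-padded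
  lexmax move (weights `(33,22,22,12,12)`) has at the exceptional point `e_l` the successor `h` again after the twist
  `z ↦ z + w`.
-/

set_option linter.dupNamespace false -- mandated namespace of this single-conjunct summit
set_option autoImplicit false

namespace Summit.ResolutionOfSingularities.ResolutionOfSingularities.Theorems

namespace GradedGame

open MvPowerSeries
open Literature.AlgebraicGeometry.Resolution

variable {k : Type} [Field k]

/-! ## A0b: the saturated move wins -/

/-- §2 A0b — THE SATURATED MOVE WINS.  For `Z^q + x·y^{qm}` (`0 = Z, 1 = x, 2 = y`; twisted iso-stratum = the `x`-axis)
the move with centre `V(Z, y) ⊇ x`-axis and weights `(m, 0, 1)` has NO singular successor at all (every exceptional point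
sees a non-zero constant or the linear term `c^{qm} x`).  Every field; `q, m > 0`. [OURS · L1 W4.3, Sketch-L1-idea-1 v4 §2
A0b, signature verbatim] -/
theorem umbrella_saturated_wins (q m : ℕ) (hq : 0 < q) (hm : 0 < m) (c : Fin 3 → k)
    (hc : ∃ i, 0 < (![m, 0, 1] : Fin 3 → ℕ) i ∧ c i ≠ 0) (a : ℕ) (g : MvPowerSeries (Fin 4) k)
    (h : subst (CobordantGame.cruxChart k ![m, 0, 1] c) ((X 0 ^ q + X 1 * X 2 ^ (q * m) : MvPowerSeries (Fin 3) k))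
      = X (0 : Fin 4) ^ a * g)
    (hg : ¬ (X (0 : Fin 4) ∣ g)) :
    ¬ CobordantGame.IsSingular k g := by
  classical
  set w : Fin 3 → ℕ := ![m, 0, 1] with hw
  set P : MvPolynomial (Fin 3) k := MvPolynomial.X 0 ^ q + MvPolynomial.X 1 * MvPolynomial.X 2 ^ (q * m) with hPdef
  have hw0 : w 0 = m := rfl
  have hw1 : w 1 = 0 := rfl
  have hw2 : w 2 = 1 := rfl
  have hcoe : (P : MvPowerSeries (Fin 3) k) = X 0 ^ q + X 1 * X 2 ^ (q * m) := by
    simp [hPdef, MvPolynomial.coe_add, MvPolynomial.coe_mul, MvPolynomial.coe_pow, MvPolynomial.coe_X]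
  have hP : P.IsWeightedHomogeneous w (q * m) := by
    have h0 := MvPolynomial.isWeightedHomogeneous_X (R := k) w 0
    have h1 := MvPolynomial.isWeightedHomogeneous_X (R := k) w 1
    have h2 := MvPolynomial.isWeightedHomogeneous_X (R := k) w 2
    rw [hw0] at h0
    rw [hw1] at h1
    rw [hw2] at h2
    have hA : (MvPolynomial.X 0 ^ q : MvPolynomial (Fin 3) k).IsWeightedHomogeneous w (q • m) := h0.pow q
    have hB : (MvPolynomial.X 1 * MvPolynomial.X 2 ^ (q * m) : MvPolynomial (Fin 3) k).IsWeightedHomogeneous w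
        (0 + (q * m) • 1) := h1.mul (h2.pow (q * m))
    rw [smul_eq_mul] at hA
    rw [smul_eq_mul, mul_one, zero_add] at hB
    rw [hPdef]
    exact hA.add hB
  have hP0 : P ≠ 0 := by
    intro h0
    have := congrArg (MvPolynomial.coeff (Finsupp.single (0 : Fin 3) q)) h0
    rw [hPdef, MvPolynomial.coeff_add, MvPolynomial.coeff_X_pow, if_pos rfl, MvPolynomial.coeff_zero,
      MvPolynomial.coeff_X_mul', if_neg (by simp), add_zero] at this
    exact one_ne_zero this
  have hcone : ∀ c : Fin 3 → k, (∀ i, w i = 0 → c i = 0) → MvPolynomial.eval c P = 0 →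
      (∀ i, MvPolynomial.eval c (MvPolynomial.pderiv i P) = 0) → c = 0 := by
    intro c hc0 hPc hD
    have hc1 : c 1 = 0 := hc0 1 hw1
    have hpd : MvPolynomial.pderiv 1 P = MvPolynomial.X 2 ^ (q * m) := by
      rw [hPdef, map_add, (MvPolynomial.pderiv 1).leibniz_pow, (MvPolynomial.pderiv 1).leibniz,
        (MvPolynomial.pderiv 1).leibniz_pow, MvPolynomial.pderiv_X, MvPolynomial.pderiv_X, MvPolynomial.pderiv_X]
      simp
    have hD1 := hD 1
    rw [hpd, map_pow, MvPolynomial.eval_X] at hD1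
    have hc2 : c 2 = 0 := (pow_eq_zero_iff (Nat.mul_pos hq hm).ne').mp hD1
    rw [hPdef] at hPc
    simp only [map_add, map_mul, map_pow, MvPolynomial.eval_X, hc1, zero_mul, add_zero] at hPc
    have hc0' : c 0 = 0 := (pow_eq_zero_iff hq.ne').mp hPc
    funext i
    fin_cases i
    · exact hc0'
    · exact hc1
    · exact hc2
  have hfac : subst (fun i : Fin 3 => if 0 < w i then
      X (0 : Fin (3 + 1)) ^ (w i) * (C (c i) + X i.succ) else X i.succ)
      (subst (X : Fin 3 → MvPowerSeries (Fin 3) k) (P : MvPowerSeries (Fin 3) k)) = X 0 ^ a * g := by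
    rw [MvPowerSeries.subst_self, id, hcoe]
    exact h
  have hwin := crux_move_wins_of_isWeightedHomogeneous_offVertex w hP hP0 hcone c hc a g hfac hg
  exact fun hs => hwin ⟨hs.2.1, hs.2.2⟩

/-! ## Shared bookkeeping for the reproduction specimens -/

/-- A product of two series with zero constant terms has no constant and no linear terms. [OURS · L1 W4.3] -/
theorem constantCoeff_and_linear_eq_zero_of_mul {N : ℕ} (φ ψ : MvPowerSeries (Fin N) k) (hφ : constantCoeff φ = 0)
    (hψ : constantCoeff ψ = 0) :
    constantCoeff (φ * ψ) = 0 ∧ ∀ i, coeff (Finsupp.single i 1) (φ * ψ) = 0 :=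
  ⟨by rw [map_mul, hφ, zero_mul], fun i => coeff_single_one_mul_eq_zero φ ψ hφ hψ i⟩

/-- If `X s ∣ φ` then the coefficients of `φ` off `X s` vanish (one direction of `X_dvd_iff`, as a rewrite helper).
[OURS · L1 W4.3] -/
theorem coeff_eq_zero_of_X_dvd {N : ℕ} {s : Fin N} {φ : MvPowerSeries (Fin N) k} (h : (X s : MvPowerSeries (Fin N) k) ∣ φ)
    (m : Fin N →₀ ℕ) (hm : m s = 0) : coeff m φ = 0 :=
  X_dvd_iff.mp h m hm

/-! ## A0a: reproduction is translation (the umbrella tower) -/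

/-- §2 A0a — REPRODUCTION IS TRANSLATION.  Char `p`, `q = p^e ≥ p`: the umbrella `f = Z^q + x y^q` (`0 = Z, 1 = x, 2 = y`)
under the POINTWISE lexmax move (weights `(q+1, q, q)`, centre the origin) has at the totally wild point `c = (0, γ^q, 0)`
the `s`-saturated transform `g = Z^q + (γ^q + x) y^q` (exponent `q² + q`; variables of `k⟦s, Z, x, y⟧` numbered `0,1,2,3`),
`g` is singular, and `g` IS the cylinder over the umbrella after the twist `Z ↦ Z + γ y`.
[OURS · L1 W4.3, Sketch-L1-idea-1 v4 §2 A0a — the sketch's `let`-bound statement with the `let`s expanded; `γ ≠ 0` is not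
needed for these identities.  The case `q = p`, `γ = 1` in `IsSuccessorAt` packaging is `GradedGame.isSuccessorAt_umbrella`
(`…GradedSliceRank`, res-type-060).] -/
theorem umbrella_reproduces (p e : ℕ) [Fact p.Prime] [CharP k p] (he : 0 < e) (γ : k) :
    subst (CobordantGame.cruxChart k ![p ^ e + 1, p ^ e, p ^ e] ![0, γ ^ p ^ e, 0])
        (X 0 ^ p ^ e + X 1 * X 2 ^ p ^ e : MvPowerSeries (Fin 3) k)
      = X (0 : Fin 4) ^ (p ^ e * p ^ e + p ^ e) * (X 1 ^ p ^ e + (C (γ ^ p ^ e) + X 2) * X 3 ^ p ^ e)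
    ∧ ¬ (X (0 : Fin 4) ∣ (X 1 ^ p ^ e + (C (γ ^ p ^ e) + X 2) * X 3 ^ p ^ e : MvPowerSeries (Fin 4) k))
    ∧ CobordantGame.IsSingular k (X 1 ^ p ^ e + (C (γ ^ p ^ e) + X 2) * X 3 ^ p ^ e : MvPowerSeries (Fin 4) k)
    ∧ (X 1 ^ p ^ e + (C (γ ^ p ^ e) + X 2) * X 3 ^ p ^ e : MvPowerSeries (Fin 4) k)
      = subst (fun i : Fin 4 => if i = 1 then X 1 + C γ * X 3 else (X i : MvPowerSeries (Fin 4) k))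
          (X 1 ^ p ^ e + X 2 * X 3 ^ p ^ e : MvPowerSeries (Fin 4) k) := by
  classical
  have hp : p.Prime := Fact.out
  set q : ℕ := p ^ e with hq
  have hq0 : q ≠ 0 := pow_ne_zero e hp.ne_zero
  have hq2 : 2 ≤ q := by
    calc 2 ≤ p := hp.two_le
      _ = p ^ 1 := (pow_one p).symm
      _ ≤ p ^ e := Nat.pow_le_pow_right hp.pos he
  obtain ⟨r, hr⟩ : ∃ r, q = r + 1 + 1 := ⟨q - 2, by omega⟩
  haveI : CharP (MvPowerSeries (Fin 4) k) p := charP_of_injective_ringHom C_injective p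
  -- the chart family at the wild point
  set ch := CobordantGame.cruxChart k ![q + 1, q, q] ![(0 : k), γ ^ q, 0] with hch
  have hch0 : ch 0 = X 0 ^ (q + 1) * X 1 := by
    simp [hch, CobordantGame.cruxChart]
  have hch1 : ch 1 = X 0 ^ q * (C (γ ^ q) + X 2) := by
    simp [hch, CobordantGame.cruxChart, Nat.pos_of_ne_zero hq0]
  have hch2 : ch 2 = X 0 ^ q * X 3 := by
    simp [hch, CobordantGame.cruxChart, Nat.pos_of_ne_zero hq0]
  have hchs : HasSubst ch := hasSubst_of_constantCoeff_zero fun i => by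
    fin_cases i
    · simp [hch0, constantCoeff_X]
    · simp [hch1, constantCoeff_X, zero_pow hq0]
    · simp [hch2, constantCoeff_X]
  -- the pieces of `g` have no constant / linear terms
  have hr1 : q - 1 ≠ 0 := by omega
  have hpow : ∀ ψ : MvPowerSeries (Fin 4) k, ψ ^ q = ψ ^ (q - 1) * ψ := fun ψ => by
    rw [← pow_succ]; congr 1; omega
  have hA : constantCoeff (X 1 ^ q : MvPowerSeries (Fin 4) k) = 0 ∧
      ∀ i, coeff (Finsupp.single i 1) (X 1 ^ q : MvPowerSeries (Fin 4) k) = 0 := by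
    rw [hpow]
    exact constantCoeff_and_linear_eq_zero_of_mul _ _ (by simp [constantCoeff_X, zero_pow hr1]) (constantCoeff_X _)
  have hB : constantCoeff ((C (γ ^ q) + X 2) * X 3 ^ q : MvPowerSeries (Fin 4) k) = 0 ∧
      ∀ i, coeff (Finsupp.single i 1) ((C (γ ^ q) + X 2) * X 3 ^ q : MvPowerSeries (Fin 4) k) = 0 := by
    rw [hpow, ← mul_assoc]
    exact constantCoeff_and_linear_eq_zero_of_mul _ _ (by simp [constantCoeff_X, zero_pow hr1]) (constantCoeff_X _)
  -- the coefficient of `Z^q` in `g` is `1`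
  have hcoef : coeff (Finsupp.single (1 : Fin 4) q) (X 1 ^ q + (C (γ ^ q) + X 2) * X 3 ^ q : MvPowerSeries (Fin 4) k) = 1 := by
    rw [map_add, coeff_X_pow, if_pos rfl,
      coeff_eq_zero_of_X_dvd ((dvd_pow_self (X 3 : MvPowerSeries (Fin 4) k) hq0).mul_left _) _ (by simp), add_zero]
  refine ⟨?_, ?_, ⟨?_, ?_, ?_⟩, ?_⟩
  · -- the factorisation
    simp only [← coe_substAlgHom hchs, map_add, map_mul, map_pow, substAlgHom_X]
    rw [hch0, hch1, hch2]
    simp only [map_pow]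
    ring
  · -- `s ∤ g`
    intro hdvd
    have := coeff_eq_zero_of_X_dvd hdvd (Finsupp.single (1 : Fin 4) q) (by simp)
    rw [hcoef] at this
    exact one_ne_zero this
  · -- `g ≠ 0`
    intro h0
    have := hcoef
    rw [h0, map_zero] at this
    exact zero_ne_one this
  · rw [map_add, hA.1, hB.1, add_zero]
  · intro i
    rw [map_add, hA.2 i, hB.2 i, add_zero]
  · -- `g` is the twisted cylinder
    have hθ : HasSubst (fun i : Fin 4 => if i = 1 then X 1 + C γ * X 3 else (X i : MvPowerSeries (Fin 4) k)) :=
      hasSubst_of_constantCoeff_zero fun i => by by_cases hi : i = 1 <;> simp [hi, constantCoeff_X]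
    simp only [← coe_substAlgHom hθ, map_add, map_mul, map_pow, substAlgHom_X]
    simp only [Fin.isValue, Fin.reduceEq, ↓reduceIte]
    rw [hq, add_pow_char_pow, mul_pow, ← map_pow]
    ring

/-! ## R3-HP1: the plain lexmax loops at a tame point of HP Example 1 -/

/-- §7 R3-HP1 — PLAIN LEXMAX LOOPS AT A TAME POINT.  `h = z⁸ + l⁴w⁸ + s·w⁶u¹⁰` (char 2; `0 = z, 1 = l, 2 = w, 3 = s, 4 = u`):
under its ⊤-padded lexmax move (weights `(33,22,22,12,12)`, all tame) the `s`-saturated transform at the exceptional point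
`e_l` is `g = z⁸ + (1+l)⁴w⁸ + s w⁶u¹⁰` (exponent `264`; variables of `k⟦σ, z, l, w, s, u⟧` numbered `0..5`), `g` is singular,
and `g` is `h` again after the twist `z ↦ z + w` (`(1+l)⁴ = 1 + l⁴`, `(z+w)⁸ = z⁸ + w⁸`). [OURS · L1 W4.3, Sketch-L1-idea-1 v4 §7
R3-HP1 — the sketch's `let`-bound statement with the `let`s expanded] -/
theorem hpB_reproduces [CharP k 2] :
    subst (CobordantGame.cruxChart k ![33, 22, 22, 12, 12] ![(0 : k), 1, 0, 0, 0])
        (X 0 ^ 8 + X 1 ^ 4 * X 2 ^ 8 + X 3 * X 2 ^ 6 * X 4 ^ 10 : MvPowerSeries (Fin 5) k)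
      = X (0 : Fin 6) ^ 264 * (X 1 ^ 8 + (1 + X 2) ^ 4 * X 3 ^ 8 + X 4 * X 3 ^ 6 * X 5 ^ 10)
    ∧ ¬ (X (0 : Fin 6) ∣ (X 1 ^ 8 + (1 + X 2) ^ 4 * X 3 ^ 8 + X 4 * X 3 ^ 6 * X 5 ^ 10 : MvPowerSeries (Fin 6) k))
    ∧ CobordantGame.IsSingular k (X 1 ^ 8 + (1 + X 2) ^ 4 * X 3 ^ 8 + X 4 * X 3 ^ 6 * X 5 ^ 10 : MvPowerSeries (Fin 6) k)
    ∧ (X 1 ^ 8 + (1 + X 2) ^ 4 * X 3 ^ 8 + X 4 * X 3 ^ 6 * X 5 ^ 10 : MvPowerSeries (Fin 6) k)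
      = subst (fun i : Fin 6 => if i = 1 then X 1 + X 3 else (X i : MvPowerSeries (Fin 6) k))
          (X 1 ^ 8 + X 2 ^ 4 * X 3 ^ 8 + X 4 * X 3 ^ 6 * X 5 ^ 10 : MvPowerSeries (Fin 6) k) := by
  classical
  haveI : CharP (MvPowerSeries (Fin 6) k) 2 := charP_of_injective_ringHom C_injective 2
  have h2 : (2 : MvPowerSeries (Fin 6) k) = 0 := CharP.ofNat_eq_zero _ 2
  set ch := CobordantGame.cruxChart k ![33, 22, 22, 12, 12] ![(0 : k), 1, 0, 0, 0] with hch
  have hch0 : ch 0 = X 0 ^ 33 * X 1 := by simp [hch, CobordantGame.cruxChart]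
  have hch1 : ch 1 = X 0 ^ 22 * (1 + X 2) := by simp [hch, CobordantGame.cruxChart]
  have hch2 : ch 2 = X 0 ^ 22 * X 3 := by simp [hch, CobordantGame.cruxChart]
  have hch3 : ch 3 = X 0 ^ 12 * X 4 := by simp [hch, CobordantGame.cruxChart]
  have hch4 : ch 4 = X 0 ^ 12 * X 5 := by simp [hch, CobordantGame.cruxChart]
  have hchs : HasSubst ch := hasSubst_of_constantCoeff_zero fun i => by
    fin_cases i
    · simp [hch0, constantCoeff_X]
    · simp [hch1, constantCoeff_X]
    · simp [hch2, constantCoeff_X]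
    · simp [hch3, constantCoeff_X]
    · simp [hch4, constantCoeff_X]
  have hA : constantCoeff (X 1 ^ 8 : MvPowerSeries (Fin 6) k) = 0 ∧
      ∀ i, coeff (Finsupp.single i 1) (X 1 ^ 8 : MvPowerSeries (Fin 6) k) = 0 := by
    rw [show (X 1 ^ 8 : MvPowerSeries (Fin 6) k) = X 1 ^ 7 * X 1 by ring]
    exact constantCoeff_and_linear_eq_zero_of_mul _ _ (by simp [constantCoeff_X]) (constantCoeff_X _)
  have hB : constantCoeff ((1 + X 2) ^ 4 * X 3 ^ 8 : MvPowerSeries (Fin 6) k) = 0 ∧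
      ∀ i, coeff (Finsupp.single i 1) ((1 + X 2) ^ 4 * X 3 ^ 8 : MvPowerSeries (Fin 6) k) = 0 := by
    rw [show ((1 + X 2) ^ 4 * X 3 ^ 8 : MvPowerSeries (Fin 6) k) = ((1 + X 2) ^ 4 * X 3 ^ 7) * X 3 by ring]
    exact constantCoeff_and_linear_eq_zero_of_mul _ _ (by simp [constantCoeff_X]) (constantCoeff_X _)
  have hC' : constantCoeff (X 4 * X 3 ^ 6 * X 5 ^ 10 : MvPowerSeries (Fin 6) k) = 0 ∧
      ∀ i, coeff (Finsupp.single i 1) (X 4 * X 3 ^ 6 * X 5 ^ 10 : MvPowerSeries (Fin 6) k) = 0 := by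
    rw [show (X 4 * X 3 ^ 6 * X 5 ^ 10 : MvPowerSeries (Fin 6) k) = (X 4 * X 3 ^ 6 * X 5 ^ 9) * X 5 by ring]
    exact constantCoeff_and_linear_eq_zero_of_mul _ _ (by simp [constantCoeff_X]) (constantCoeff_X _)
  have hcoef : coeff (Finsupp.single (1 : Fin 6) 8)
      (X 1 ^ 8 + (1 + X 2) ^ 4 * X 3 ^ 8 + X 4 * X 3 ^ 6 * X 5 ^ 10 : MvPowerSeries (Fin 6) k) = 1 := by
    rw [map_add, map_add, coeff_X_pow, if_pos rfl,
      coeff_eq_zero_of_X_dvd ((dvd_pow_self (X 3 : MvPowerSeries (Fin 6) k) (by norm_num)).mul_left _) _ (by simp),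
      coeff_eq_zero_of_X_dvd (((dvd_mul_right (X 4 : MvPowerSeries (Fin 6) k) (X 3 ^ 6)).mul_right (X 5 ^ 10))) _
        (by simp), add_zero, add_zero]
  refine ⟨?_, ?_, ⟨?_, ?_, ?_⟩, ?_⟩
  · simp only [← coe_substAlgHom hchs, map_add, map_mul, map_pow, substAlgHom_X]
    rw [hch0, hch1, hch2, hch3, hch4]
    ring
  · intro hdvd
    have := coeff_eq_zero_of_X_dvd hdvd (Finsupp.single (1 : Fin 6) 8) (by simp)
    rw [hcoef] at this
    exact one_ne_zero this
  · intro h0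
    have := hcoef
    rw [h0, map_zero] at this
    exact zero_ne_one this
  · rw [map_add, map_add, hA.1, hB.1, hC'.1, add_zero, add_zero]
  · intro i
    rw [map_add, map_add, hA.2 i, hB.2 i, hC'.2 i, add_zero, add_zero]
  · have hθ : HasSubst (fun i : Fin 6 => if i = 1 then X 1 + X 3 else (X i : MvPowerSeries (Fin 6) k)) :=
      hasSubst_of_constantCoeff_zero fun i => by by_cases hi : i = 1 <;> simp [hi, constantCoeff_X]
    simp only [← coe_substAlgHom hθ, map_add, map_mul, map_pow, substAlgHom_X]
    simp only [Fin.isValue, Fin.reduceEq, ↓reduceIte]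
    linear_combination (2 * X 2 * X 3 ^ 8 + 3 * X 2 ^ 2 * X 3 ^ 8 + 2 * X 2 ^ 3 * X 3 ^ 8
      - (4 * X 1 ^ 7 * X 3 + 14 * X 1 ^ 6 * X 3 ^ 2 + 28 * X 1 ^ 5 * X 3 ^ 3 + 35 * X 1 ^ 4 * X 3 ^ 4
        + 28 * X 1 ^ 3 * X 3 ^ 5 + 14 * X 1 ^ 2 * X 3 ^ 6 + 4 * X 1 * X 3 ^ 7) : MvPowerSeries (Fin 6) k) * h2

end GradedGame

end Summit.ResolutionOfSingularities.ResolutionOfSingularities.Theorems
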